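/-
Origin: expansion seat `planner-pub-hodgecm-qw8-g6-0`, handover #1(5) 2026-08-18T08:50:23Z (`HOME/pub-hodgecm-qw8-g6/lean/Qw8g6/LefDescent.lean`, md5 8333f2b6, 114 lines);
landed by the gen-7 packager in gate run 27 as `HodgeCM/Model/Toy/LefDescent.lean` (import ^import Qw8g6\.→import HodgeCM.Model.Toy. ×1).
-/
-- HANDOVER (planner-pub-hodgecm-qw8-g6-0, unit pub-hodgecm-qw8-g6): WIP module `Qw8g6.LefDescent`; intended final module
-- `HodgeCM.Model.Toy.LefDescent` (kind L5, separating model); rename `import Qw8g6.X` ↦ `import HodgeCM.Model.Toy.X`.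
/-
Copyright: pub-hodgecm cell (HodgeCMPerL). Separating-model layer (gens 5–6 of the [QW8] §2.5 lineage). New file.

# Balanced Gysin descent in the exterior CM-model

The `Bal`-half of F7d-B for the Lefschetz model: for a block pair `(p_Y, p_{Y'})` of a CM product `P = Y × Y'`, a
nonzero rational top class `ω` of `Y'` and `e ∈ H^{2p}(Y, ℚ)`,

  `p_Y^* e ∪ p_{Y'}^* ω ∈ Bal(P)  ⇒  e ∈ Bal(Y)`.

Same bookkeeping as the Hodge half `GysinWitness.descent_b` (`HodgeCM.Model.Toy.ToyGysinDescent`) with the bigraded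
pair `(FF, GG)` replaced by `(balSpan, unbSpan)` of `HodgeCM.Model.Toy.LefTypes`: `bal ∧ bal ⊆ bal`, `unb ∧ bal ⊆ unb`,
`bal ∩ unb = 0`, the top class of the CM product `Y'` is balanced (`Obj.top_mem_balSpan`), and (a)_ℂ
(`Universe.boxC_ne_zero_succ`) kills the unbalanced component.
-/
import Mathlib
import Summits.HodgeConjecture.HodgeCM.Model.Toy.LefModel

/-! PORT of `HodgeCM/Model/Toy/LefDescent.lean` (HodgeCMPerL run 82) — verbatim mechanical port; provenance in the PORT header line. -/

noncomputable section

set_option backward.isDefEq.respectTransparency false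

namespace HodgeCM.Toy

open scoped TensorProduct
open exteriorPower Module
open Literature.AlgebraicGeometry.Motives
open Literature.AlgebraicGeometry.Motives.HodgeStructure (ofRat ofRat_apply mem_hodgeClasses_iff)
open GysinWitness

set_option maxHeartbeats 800000 in
/-- **Balanced Gysin descent**: `p_Y^* e ∪ p_{Y'}^* ω ∈ Bal^{2(p+d')}(P) ⇒ e ∈ Bal^{2p}(Y)` for a block pair and a
nonzero top class `ω` of `Y'` (heartbeats: `400000` times out in the final `pullC_castC / cupC_castC_left` rewrite
chain, which unfolds the structure projections at the CM products — half the budget of the landed Hodge half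
`GysinWitness.descent_b`). -/
theorem bal_descent {F : CMField} {n m : ℕ} (Ξ : Fin (n + 1 + (m + 1)) → CMType F)
    {pA : TM.Mor (TM.cmProd F Ξ) (TM.cmProd F (blkA Ξ))} {pB : TM.Mor (TM.cmProd F Ξ) (TM.cmProd F (blkB Ξ))}
    (hP : TM.IsBlockPair F Ξ pA pB) {ω : TM.Coh (TM.cmProd F (blkB Ξ)) (2 * TM.dim (TM.cmProd F (blkB Ξ)))}
    (hω : ω ≠ 0) (p : ℕ) (e : TM.Coh (TM.cmProd F (blkA Ξ)) (2 * p))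
    (he : TM.castCoh (TM.cmProd F Ξ)
      (by omega : 2 * p + 2 * TM.dim (TM.cmProd F (blkB Ξ)) = 2 * (p + TM.dim (TM.cmProd F (blkB Ξ))))
      (TM.cup (TM.cmProd F Ξ) (2 * p) _ (TM.pull pA (2 * p) e) (TM.pull pB _ ω)) ∈
        (TM.cmProd F Ξ).balQ (2 * (p + TM.dim (TM.cmProd F (blkB Ξ))))) :
    e ∈ (TM.cmProd F (blkA Ξ)).balQ (2 * p) := by
  rw [castCoh_mem_balQ_iff, Obj.mem_balQ] at he
  rw [Obj.mem_balQ]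
  -- complexify the box
  have hbox : (ofRat (TM.cup (TM.cmProd F Ξ) (2 * p) _ (TM.pull pA (2 * p) e) (TM.pull pB _ ω)) :
      TM.CohC (TM.cmProd F Ξ) (2 * p + 2 * TM.dim (TM.cmProd F (blkB Ξ)))) =
        TM.cupC (TM.cmProd F Ξ) (2 * p) _ (TM.pullC pA (2 * p) (ofRat e)) (TM.pullC pB _ (ofRat ω)) := by
    rw [ofRat_apply, ofRat_apply, ofRat_apply, Universe.pullC_tmul, Universe.pullC_tmul, Universe.cupC_tmul,
      mul_one]
  -- `Θ(1 ⊗ e) = f + g`, `f` balanced, `g` unbalanced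
  obtain ⟨f, hf, g, hg, hfg⟩ := Submodule.mem_sup.mp
    (show (TM.cmProd F (blkA Ξ)).Θ (2 * p) (ofRat e) ∈
        (TM.cmProd F (blkA Ξ)).balSpan (2 * p) ⊔ (TM.cmProd F (blkA Ξ)).unbSpan (2 * p) by
      rw [Obj.balSpan_sup_unbSpan]; exact Submodule.mem_top)
  -- the top class of the CM product `Y'` is balanced
  have hcard : Fintype.card (TM.cmProd F (blkB Ξ)).Idx = 2 * TM.dim (TM.cmProd F (blkB Ξ)) :=
    (two_mul_dim_eq_card F (blkB Ξ)).symm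
  have hωB : (TM.cmProd F (blkB Ξ)).Θ _ (ofRat ω) ∈
      (TM.cmProd F (blkB Ξ)).balSpan (2 * TM.dim (TM.cmProd F (blkB Ξ))) :=
    Obj.top_mem_balSpan (isCMObj_cmProd exteriorHodgeData F (blkB Ξ)) hcard _
  -- images in `P`
  have hAf : exteriorPower.map (2 * p) (pA.lin.baseChange ℂ) f ∈ (TM.cmProd F Ξ).balSpan (2 * p) :=
    Obj.balSpan_map_le pA _ ⟨f, hf, rfl⟩
  have hAg : exteriorPower.map (2 * p) (pA.lin.baseChange ℂ) g ∈ (TM.cmProd F Ξ).unbSpan (2 * p) :=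
    Obj.unbSpan_map_le pA _ ⟨g, hg, rfl⟩
  have hB : exteriorPower.map _ (pB.lin.baseChange ℂ) ((TM.cmProd F (blkB Ξ)).Θ _ (ofRat ω)) ∈
      (TM.cmProd F Ξ).balSpan (2 * TM.dim (TM.cmProd F (blkB Ξ))) :=
    Obj.balSpan_map_le pB _ ⟨_, hωB, rfl⟩
  -- split the hypothesis along `f + g`
  rw [hbox, theta_boxC, ← hfg, map_add, map_add, LinearMap.add_apply] at he
  have hFF := (TM.cmProd F Ξ).wedge_mem_balSpan _ _ hAf hB
  have hGG := (TM.cmProd F Ξ).wedge_mem_unbSpan _ _ hAg hB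
  have hGF : wedge ℂ (TM.cmProd F Ξ).LC _ _ (exteriorPower.map (2 * p) (pA.lin.baseChange ℂ) g)
      (exteriorPower.map _ (pB.lin.baseChange ℂ) ((TM.cmProd F (blkB Ξ)).Θ _ (ofRat ω))) ∈
        (TM.cmProd F Ξ).balSpan (2 * p + 2 * TM.dim (TM.cmProd F (blkB Ξ))) := by
    have h' := Submodule.sub_mem _ he hFF
    rwa [add_sub_cancel_left] at h'
  have hzero : wedge ℂ (TM.cmProd F Ξ).LC _ _ (exteriorPower.map (2 * p) (pA.lin.baseChange ℂ) g)
      (exteriorPower.map _ (pB.lin.baseChange ℂ) ((TM.cmProd F (blkB Ξ)).Θ _ (ofRat ω))) = 0 :=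
    Submodule.disjoint_def.mp ((TM.cmProd F Ξ).disjoint_balSpan_unbSpan _) _ hGF hGG
  -- (a)_ℂ in positive degree ⇒ `g = 0`; in degree `0`, `unbSpan⁰ = 0`
  have hg0 : g = 0 := by
    rcases Nat.eq_zero_or_pos p with hp | hp
    · subst hp
      have hbot : (TM.cmProd F (blkA Ξ)).unbSpan (2 * 0) = ⊥ := Obj.unbSpan_zero _
      rw [hbot] at hg
      exact hg
    · obtain ⟨k, hk⟩ : ∃ k, 2 * p = k + 1 := ⟨2 * p - 1, by omega⟩
      by_contra hg0
      have hx0 : ((TM.cmProd F (blkA Ξ)).Θ (2 * p)).symm g ≠ 0 := fun h =>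
        hg0 ((LinearEquiv.map_eq_zero_iff _).mp h)
      have hx1 : TM.castC (TM.cmProd F (blkA Ξ)) hk (((TM.cmProd F (blkA Ξ)).Θ (2 * p)).symm g) ≠ 0 := fun h =>
        hx0 ((LinearEquiv.map_eq_zero_iff _).mp h)
      apply Universe.boxC_ne_zero_succ Ξ tM toyModel_fact_cupExterior (fact_cupAssoc _) (GysinWitness.fact_dimProd _)
        hP hx1 (ofRat_ne_zero hω)
      rw [Universe.pullC_castC, Universe.cupC_castC_left, LinearEquiv.map_eq_zero_iff,
        ← LinearEquiv.map_eq_zero_iff ((TM.cmProd F Ξ).Θ (2 * p + 2 * TM.dim (TM.cmProd F (blkB Ξ)))), theta_boxC,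
        LinearEquiv.apply_symm_apply]
      exact hzero
  rw [← hfg, hg0, add_zero]
  exact hf

/-- F7d-B-`B`: the `B`-descent hypothesis `Universe.BalDescentB` of `Universe.Fact_gysinDescentB.balMod` for
`B = Bal` over the exterior CM-model. -/
theorem bal_descentB : EM.BalDescentB balB := fun _ _ _ Ξ _ _ hP _ hω p e he => bal_descent Ξ hP hω p e he

end HodgeCM.Toy

end
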